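import Literature.Geometry.Symplectic.AlmostComplexStructure
import Literature.Topology.FourManifolds.ComplexProjectiveSpaceCohomology
import Literature.Topology.PlaneTopology.WindingNumber
import Mathlib.Geometry.Manifold.Instances.Sphere
import HarnessLib

/-!
# The intersection number of a sphere with a compact co-oriented surface `{π = 0}` is homological

Named fact (D-0014) requested by the crux chain of `GromovRecognitionRelEnd` (item
stmt-SmoothPoincare4-11009, line `cross-cap-laurent`, glue stub `stub_coreGlue`; dossier
`Summits/SmoothPoincare4/SmoothPoincare4/Cruxes/GromovRecognitionRelEnd/Lines/cross-cap-laurent-core-c3.md`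
§4 (G)): the TOPOLOGICAL companion of `Literature.Geometry.Symplectic.jSphere_wedgeCount_factorsThroughHomology`
(there the surface is a `J`-holomorphic curve `{T = 0}` and the local index is the order of
vanishing; here the surface is any compact regular zero set `{π = 0}` of a smooth `ℂ`-valued
submersion — e.g. a LEAF of the local foliations of `hls_localFoliation_embeddedSphere_trivialNormal`
inside the region where the almost complex structure is not integrable — and the local index is
the winding number `Literature.Topology.PlaneTopology.wind` of `π ∘ u` on small circles, as in
`Literature.Geometry.Symplectic.positivityOfIntersections_leafCoordinate`). It is what makes the sum
of the local intersection indices of a V-leaf with an H-leaf equal to `[V] · [H] = 1`.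

## What is printed

* G. E. Bredon, *Topology and Geometry*, GTM 139 (1993), Ch. VI §11 ("Intersection theory"),
  Thm. 11.9–Cor. 11.12: for closed oriented manifolds the intersection product is Poincaré dual to
  the cup product, and for `N`, `K` meeting suitably `[N] • [K]` is the sum of the LOCAL
  INTERSECTION NUMBERS; the local intersection number of a map with a co-oriented submanifold
  given as a regular zero set `{π = 0}` at an isolated intersection is the LOCAL DEGREE of `π ∘ u`
  (V. Guillemin, A. Pollack, *Differential Topology* (1974), Ch. 3 §3, intersection number =
  sum of local degrees, homotopy invariance); in the plane the local degree is the winding number.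
* R. Bott, L. W. Tu, *Differential Forms in Algebraic Topology* (1982), §6: the Poincaré dual of a
  closed oriented submanifold; `A ↦ ⟨PD[K], A⟩` is additive on `H₂`.

## The form vendored here

`X` a compact 4-manifold, oriented by an almost complex structure `JX` (only used to fix the
orientation); `π` smooth with surjective differential on an open `U`, zero set
`K = {y ∈ U | π y = 0}` COMPACT (a closed co-oriented surface). CONCLUSION: there is an additive
`c : H₂(X; ℤ) → ℤ` such that for every SMOOTH two-chart sphere `(u, v)` (`v z = u z⁻¹`; no
holomorphicity) meeting `K` at finitely many parameter values and with glued map `F : ℂℙ¹ → X`,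
for all sufficiently small radii `r`, `c (F_*[ℂℙ¹])` is the sum over the `z` with `u z ∈ K` of
`wind (t ↦ π (u (circleLoop z r t)))` plus, if `v 0 ∈ K`, `wind (t ↦ π (v (circleLoop 0 r t)))`.
(The sign conventions are absorbed in `c`; only existence is recorded.)
-- TODO(general form): arbitrary closed oriented surfaces mapped into `X`, and the identification
-- of `c` with the intersection form / Poincaré duality, are not recorded.
Nothing is asserted: users take `(h : sphere_zeroSetIndex_factorsThroughHomology)`; SIZE L–XL over
the tree's singular homology (Thom class of `K`, local degree = winding number).

## References

* G. E. Bredon, *Topology and Geometry*, GTM 139, Springer (1993), VI.11, Thm. 11.9–Cor. 11.12. [Bredon1993]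
* V. Guillemin, A. Pollack, *Differential Topology*, Prentice–Hall (1974), Ch. 3 §3. [GuilleminPollack1974]
* R. Bott, L. W. Tu, *Differential Forms in Algebraic Topology*, GTM 82 (1982), §6. [BottTu1982Forms]
-/

noncomputable section

open scoped Manifold ContDiff Topology
open Set Function Literature.Topology.FourManifolds Literature.Topology.FourManifolds.ComplexProjectiveSpace
  Literature.AlgebraicTopology.SingularHomology Literature.Topology.PlaneTopology

namespace Literature.Geometry.Symplectic

/-- **The intersection indices of smooth spheres with a compact co-oriented surface `K = {π = 0}`
add up to a homological invariant** (Bredon 1993, VI.11 Thm. 11.9–Cor. 11.12; Guillemin–Pollack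
1974, Ch. 3 §3; Bott–Tu §6). `X` compact almost complex 4-manifold, `π` a smooth submersion on the
open `U` with compact zero set `K`: there is an additive `c : H₂(X; ℤ) → ℤ` such that for every
smooth two-chart sphere `(u, v)` meeting `K` at finitely many parameters, with glued map `F`,
`c (F_*[ℂℙ¹])` equals, for all small radii `r`, the sum of the winding numbers of `π ∘ u` on the
circles of radius `r` about the points `z` with `u z ∈ K`, plus that of `π ∘ v` about `0` if
`v 0 ∈ K`. [cite: Bredon1993, VI.11 (Thm. 11.9–Cor. 11.12)] [cite: GuilleminPollack1974, Ch. 3 §3] [cite: BottTu1982Forms, §6] -/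
def sphere_zeroSetIndex_factorsThroughHomology : Prop :=
  ∀ (X : Type) [TopologicalSpace X] [T2Space X] [SecondCountableTopology X] [CompactSpace X]
    [ChartedSpace (EuclideanSpace ℝ (Fin 4)) X] [IsManifold (𝓡 4) ∞ X]
    (_JX : AlmostComplexStructure (𝓡 4) ∞ X) (π : X → ℂ) (U : Set X),
    IsOpen U → ContMDiffOn (𝓡 4) 𝓘(ℝ, ℂ) ∞ π U →
    (∀ y ∈ U, Surjective (mfderiv (𝓡 4) 𝓘(ℝ, ℂ) π y)) →
    IsCompact {y : X | y ∈ U ∧ π y = 0} →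
    ∃ c : singularHomology ℤ ℤ X (2 * 1) →+ ℤ,
      ∀ (u v : ℂ → X) (F : C(ComplexProjectiveSpace 1, X)),
        ContMDiff 𝓘(ℝ, ℂ) (𝓡 4) ∞ u → ContMDiff 𝓘(ℝ, ℂ) (𝓡 4) ∞ v → (∀ z : ℂ, z ≠ 0 → v z = u z⁻¹) →
        (∀ p, CoordNeZero 0 p → F p = u (affineCoordComplex 0 p 0)) →
        (∀ p, CoordNeZero 1 p → F p = v (affineCoordComplex 1 p 0)) →
        {z : ℂ | u z ∈ U ∧ π (u z) = 0}.Finite →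
        ∃ r₀ : ℝ, 0 < r₀ ∧ ∀ r : ℝ, 0 < r → r ≤ r₀ →
          c (singularHomology.map ℤ ℤ F (2 * 1)
              (ComplexProjectiveSpace.homologicalOrientationInt 1).fundamentalClass) =
            (∑ᶠ z ∈ {z : ℂ | u z ∈ U ∧ π (u z) = 0}, wind (fun t => π (u (circleLoop z r t)))) +
            (∑ᶠ w ∈ {w : ℂ | w = 0 ∧ v w ∈ U ∧ π (v w) = 0}, wind (fun t => π (v (circleLoop w r t))))

end Literature.Geometry.Symplectic

end
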